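import Mathlib
import Summits.Ventures.PercRepro2.TypedReduce5U
import Summits.Ventures.PercRepro2.TypedSeparatedAll

/-!
# The typed reduction calculus over the base «|F| ≤ 5, or a root untouched, or separated»
(blind cell PercRepro2, night-3 g5, 2026-08-25; `proofs/NIGHT3-CERT.md` §14.11)

`RedM5S := RedMGen Base5S` with `Base5S = |F| ≤ 5 ∨ C_z(a₁) untouched ∨ C_z(a₂) untouched ∨
a₁ ↮ a₂ in z ∪ F`: the rules of `RedM` over every base instance the cell now holds in the
kernel — the |F| ≤ 5 rung (`FiveTypedAll`), the root-untouched vanishing (`TypedUntouched`) and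
the separated class (`TypedSeparatedAll`).  `typedCount_nonneg_of_redM5S` is row 2′TRI on the
class, `redM5S_of_redM5U` the inclusion, `Gc_nonneg_of_redM5S` / `ZDelta_of_redM5S` the weighted
corollaries.  What is left of the row is exactly the residual class of sub-claim S4: connected
roots, ≥ 6 typed edges after the rules, all four of `a₁, a₂, o, b` touched.
-/

namespace Summit.Ventures.PercRepro2

open UnionCluster

namespace CovForm

namespace TypedRed

open Contract

section RedM5S

variable {V : Type*} {E : Type*} [DecidableEq V] [Fintype E] [DecidableEq E]

/-- The base of `RedM5S`: at most five typed edges, or a pinned root cluster untouched, or the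
roots separated in `z ∪ F`. -/
def Base5S (ends : E → Sym2 V) (_o a₁ a₂ _a₃ _b : V) (F : Finset E) (z : Config E)
    (_τ : E → ℕ) : Prop :=
  F.card ≤ 5 ∨ Untouched.UntouchedBy ends F z a₁ ∨ Untouched.UntouchedBy ends F z a₂ ∨
    Separated.Sep ends a₁ a₂ F z

/-- **The reducible class with base `|F| ≤ 5 ∨ root untouched ∨ separated`.** -/
abbrev RedM5S : (E → Sym2 V) → V → V → V → V → V → Finset E → Config E → (E → ℕ) → Prop :=
  RedMGen Base5S

variable {R : Type*} [Field R] [LinearOrder R] [IsStrictOrderedRing R]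

omit [DecidableEq V] in
/-- The typed count is nonnegative on the base `Base5S`. -/
theorem typedCount_nonneg_of_base5S (ends : E → Sym2 V) (o a₁ a₂ a₃ b : V) (F : Finset E)
    (z : Config E) (τ : E → ℕ) (hB : Base5S ends o a₁ a₂ a₃ b F z τ)
    (hτ : ∀ e ∈ F, τ e = 1 ∨ τ e = 2) :
    0 ≤ typedCount F z τ (K3 ends o a₁ a₂ a₃ b : Config E → Config E → Config E → R) := by
  rcases hB with h5 | h1 | h2 | hs
  · exact TwoTyped.typedCount_nonneg_of_card_le_five' ends o a₁ a₂ a₃ b F h5 z τ hτ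
  · rw [Untouched.typedCount_eq_zero_of_untouched_a1 ends o a₁ a₂ a₃ b F z τ hτ h1]
  · rw [Untouched.typedCount_eq_zero_of_untouched_a2 ends o a₁ a₂ a₃ b F z τ hτ h2]
  · exact Separated.typedCount_nonneg_of_separated ends o a₁ a₂ a₃ b F z τ hτ hs

/-- **Row 2′TRI on `RedM5S`.** -/
theorem typedCount_nonneg_of_redM5S {ends : E → Sym2 V} {o a₁ a₂ a₃ b : V} {F : Finset E}
    {z : Config E} {τ : E → ℕ} (h : RedM5S ends o a₁ a₂ a₃ b F z τ)
    (hτ : ∀ e ∈ F, τ e = 1 ∨ τ e = 2) :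
    0 ≤ typedCount F z τ (K3 ends o a₁ a₂ a₃ b : Config E → Config E → Config E → R) :=
  typedCount_nonneg_of_redMGen (fun ends o a₁ a₂ a₃ b F z τ hB hτ =>
    typedCount_nonneg_of_base5S ends o a₁ a₂ a₃ b F z τ hB hτ) h hτ

omit [Fintype E] in
/-- `RedM5U ⊆ RedM5S`. -/
theorem redM5S_of_redM5U {ends : E → Sym2 V} {o a₁ a₂ a₃ b : V} {F : Finset E} {z : Config E}
    {τ : E → ℕ} (h : RedM5U ends o a₁ a₂ a₃ b F z τ) : RedM5S ends o a₁ a₂ a₃ b F z τ := by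
  induction h with
  | base ends o a₁ a₂ a₃ b F z τ hF =>
    refine RedMGen.base ends o a₁ a₂ a₃ b F z τ ?_
    rcases hF with h5 | h1 | h2
    · exact Or.inl h5
    · exact Or.inr (Or.inl h1)
    · exact Or.inr (Or.inr (Or.inl h2))
  | @contract ends o a₁ a₂ a₃ b F z τ g u v hg hgF hz _ ih =>
    exact RedMGen.contract ends o a₁ a₂ a₃ b F z τ hg hgF hz ih
  | @rootPair ends o a₁ a₂ a₃ b F z τ f hf hfF =>
    exact RedMGen.rootPair ends o a₁ a₂ a₃ b F z τ hf hfF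
  | @loop ends o a₁ a₂ a₃ b F z τ f u hf hfF _ ih =>
    exact RedMGen.loop ends o a₁ a₂ a₃ b F z τ hf hfF ih
  | @leaf ends o a₁ a₂ a₃ b F z τ f l u hf hlu hlo hl1 hl2 hl3 hlb hfF hcl _ ih =>
    exact RedMGen.leaf ends o a₁ a₂ a₃ b F z τ hf hlu hlo hl1 hl2 hl3 hlb hfF hcl ih
  | @pendantB ends o a₁ a₂ a₃ b F z τ f u hf hbu hbo hb1 hb2 hb3 hfF hcl _ ih =>
    exact RedMGen.pendantB ends o a₁ a₂ a₃ b F z τ hf hbu hbo hb1 hb2 hb3 hfF hcl ih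
  | @pendantO ends o a₁ a₂ a₃ b F z τ f u hf hou ho1 ho2 ho3 hob hfF hcl _ ih =>
    exact RedMGen.pendantO ends o a₁ a₂ a₃ b F z τ hf hou ho1 ho2 ho3 hob hfF hcl ih
  | @parallel ends o a₁ a₂ a₃ b F z τ e f hef hpar heF hfF _ _ _ ih1 ih2 ih3 =>
    exact RedMGen.parallel ends o a₁ a₂ a₃ b F z τ hef hpar heF hfF ih1 ih2 ih3
  | @series ends o a₁ a₂ a₃ b F z τ e f hef u w v he hf hwu hwv hwo hw1 hw2 hw3 hwb heF hfF hcl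
      _ _ _ ih0 ih1 ih2 =>
    exact RedMGen.series ends o a₁ a₂ a₃ b F z τ hef he hf hwu hwv hwo hw1 hw2 hw3 hwb heF hfF
      hcl ih0 ih1 ih2

/-- **(HCOV) on weight vectors whose fractional edges reduce in `RedM5S`**. -/
theorem Gc_nonneg_of_redM5S (ends : E → Sym2 V) (o a₁ a₂ a₃ b : V) (p : E → R)
    (hp : IsProbVec p)
    (hred : ∀ G : Finset E, G ⊆ (Finset.univ.filter fun e => p e ≠ 0 ∧ p e ≠ 1) →
      ∀ (z : Config E) (σ : E → ℕ), (∀ e ∈ G, σ e = 1 ∨ σ e = 2) →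
        RedM5S ends o a₁ a₂ a₃ b G z σ) :
    0 ≤ Gc p ends o a₁ a₂ a₃ b := by
  rw [hcov_cubic p ends o a₁ a₂ a₃ b (fun _ => 0)]
  refine TwoTyped.triSum_nonneg_of_typedCount_subset (K3 ends o a₁ a₂ a₃ b)
    (Finset.univ.filter fun e => p e ≠ 0 ∧ p e ≠ 1) ?_ p (fun e => ⟨hp.nonneg e, hp.le_one e⟩) ?_ ∅
    (Finset.empty_subset _) (fun _ => 0) (fun e he => absurd he (Finset.notMem_empty e))
  · intro G hG z σ hσ
    exact typedCount_nonneg_of_redM5S (hred G hG z σ hσ) hσ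
  · intro e he
    simp only [Finset.mem_filter, Finset.mem_univ, true_and, not_and, not_not] at he
    by_cases h : p e = 0
    · exact Or.inl h
    · exact Or.inr (he h)

/-- **The crux of record (ZΔ) on weight vectors whose fractional edges reduce in `RedM5S`.** -/
theorem ZDelta_of_redM5S [Fintype V] (ends : E → Sym2 V) (o a₁ a₂ a₃ b : V) (p : E → R)
    (hp : IsProbVec p)
    (hred : ∀ G : Finset E, G ⊆ (Finset.univ.filter fun e => p e ≠ 0 ∧ p e ≠ 1) →
      ∀ (z : Config E) (σ : E → ℕ), (∀ e ∈ G, σ e = 1 ∨ σ e = 2) →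
        RedM5S ends o a₁ a₂ a₃ b G z σ)
    (hord : prob p (connEvent ends a₁ b) ≤ prob p (connEvent ends a₂ b)) :
    ZDelta p ends o a₁ a₂ a₃ b :=
  ZDelta_of_HCov p hp ends hord (Gc_nonneg_of_redM5S ends o a₁ a₂ a₃ b p hp hred)

end RedM5S

end TypedRed

end CovForm

end Summit.Ventures.PercRepro2
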